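import Literature.NumberTheory.GaloisCohomology.Howard2004.SelmerTriples
import Literature.NumberTheory.GaloisRepresentations.PadicAlgClFiniteSubextensionDvr
import Literature.AlgebraicGeometry.Resolution.CompleteLocalDomainNormalizationPowerSeries
import Mathlib.NumberTheory.Padics.RingHoms
import HarnessLib

/-!
# The ring of integers of a finite extension of `ℚ_p` is a coefficient ring in Howard's sense
# (a complete Noetherian local ring with finite residue field of characteristic `p`) and a
# discrete valuation ring, module-finite over `ℤ_p` (proved theorems; no definition, no instance)

Topic `NumberTheory/GaloisCohomology/Howard2004` (namespace = path).  THEOREMS ONLY: no `def`, no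
named fact, no `instance`, no notation, no `sorry`.

B. Howard, *The Heegner point Kolyvagin system*, Compositio Math. 140 (2004), §1 conventions
(arXiv:1202.6340 p. 4, L47–52): «By a coefficient ring, `R`, we mean a complete, Noetherian, local
ring with finite residue field of characteristic `p`.  The cases of interest are when `R` is the ring
of integers `𝒪` of a finite extension of `ℚ_p`, a quotient of `𝒪`, or the Iwasawa algebra `Λ`»; §1.6
(Thm. 1.6.1): «`R` is a discrete valuation ring»; §2.2 / proof of Thm. 2.2.10: the Kolyvagin system is
specialised at a height-one prime `𝔓 ≠ pΛ` over «`S_𝔓`, the integral closure of `Λ/𝔓`» — the ring of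
integers of the finite extension `Frac(Λ/𝔓)` of `ℚ_p`.  The tree records Howard's standing hypothesis as
the `Prop` `Howard2004.IsCoefficientRing p R` (`SelmerTriples` §A) and DISCHARGES it for `Λ`,
`S_m = Λ/(T^m + p)` and `A_{m,k}` (`IwasawaAlgebraEisensteinCoefficientRingProofs`).  THIS FILE discharges
it for Howard's FIRST case of interest, the ring of integers of an arbitrary finite extension of `ℚ_p`,
modelled — as everywhere in the tree (`PadicAlgClFiniteSubextensionDvr`) — by a finite intermediate
field `E` of `ℚ̄_p = PadicAlgCl p` over `ℚ_[p]`, with `𝒪_E := integralClosure ℤ_[p] E` (a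
`ℤ_p`-subalgebra of `E`, hence a `ℤ_p`-algebra with no instance to declare; by
`PadicAlgCl.unitBall_toSubring_eq_integralClosure` it is the closed unit ball of the `p`-adic norm).

WHAT (for `E : IntermediateField ℚ_[p] (PadicAlgCl p)` with `[FiniteDimensional ℚ_[p] E]`,
`O := ↥(integralClosure ℤ_[p] ↥E)`):
* §1 `isDiscreteValuationRing_integralClosure` (transport of the tree's
  `PadicAlgCl.isDiscreteValuationRing_unitBall` along `RingEquiv.subringCongr`),
  `isNoetherianRing_integralClosure`, `module_finite_integralClosure` (Mathlib `IsIntegralClosure.finite`),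
  `module_free_integralClosure`, `finrank_integralClosure` (`rk_{ℤ_p} 𝒪_E = [E : ℚ_p]`);
* §2 `isLocalHom_algebraMap_integralClosure` (`ℤ_p → 𝒪_E` is a local homomorphism),
  `natCast_mem_maximalIdeal_integralClosure` (`p ∈ 𝔪`), `natCast_ne_zero_integralClosure`
  (`p ≠ 0` in `𝒪_E` — the first guard of the print-as-intended F-161′),
  `finite_residueField_integralClosure`, `charP_residueField_integralClosure`,
  `isAdicComplete_maximalIdeal_integralClosure` (a local ring module-finite over the complete
  Noetherian local ring `ℤ_p` is complete: the tree's
  `Resolution.isAdicComplete_maximalIdeal_of_module_finite`, Matsumura Thm. 8.7/8.15);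
* §3 **`isCoefficientRing_integralClosure : Howard2004.IsCoefficientRing p 𝒪_E`**.

HONEST FRAMING: classical local algebra (Serre, *Local Fields*, Ch. II §2 Prop. 3; Matsumura Thm. 8.7);
the statements are Howard's standing hypotheses instantiated at `R = 𝒪_E`, cited as such.  Nothing
here concerns Selmer groups or elliptic curves; no summit statement and no case of BSD is proved by
any of this.

References: [Howard2004HeegnerKolyvagin] §1 (arXiv:1202.6340 p. 4, L47–52), §1.6, §2.2 (S_𝔓) and proof
of Thm. 2.2.10; [SerreLocalFields1979] Ch. II §2, Prop. 3; [Matsumura1987] Thm. 8.7, Thm. 8.15.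
-/

set_option autoImplicit false

noncomputable section

open IsLocalRing

namespace Literature.NumberTheory.GaloisCohomology.Howard2004

open Literature.NumberTheory.GaloisRepresentations

variable {p : ℕ} [hp : Fact p.Prime] (E : IntermediateField ℚ_[p] (PadicAlgCl p))

/-! ## §1 `𝒪_E = integralClosure ℤ_p E` is a discrete valuation ring, finite free over `ℤ_p` -/

/-- **`𝒪_E` is a discrete valuation ring** — the tree's `PadicAlgCl.isDiscreteValuationRing_unitBall`
(the closed unit ball of `E` is a Noetherian valuation ring which is not a field) transported along the
identification of the unit ball with `integralClosure ℤ_[p] E`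
(`PadicAlgCl.unitBall_toSubring_eq_integralClosure`).  Howard §1.6: «`R` is a discrete valuation ring»,
at `R = 𝒪` the ring of integers of a finite extension of `ℚ_p`; §2.2: `S_𝔓` «the integral closure of
`Λ/𝔓`».
[cite: Howard2004HeegnerKolyvagin, §1 conventions (arXiv:1202.6340 p. 4, L47–52) and §1.6 Thm. 1.6.1 standing] [cite: SerreLocalFields1979, Ch. II §2, Prop. 3] -/
theorem isDiscreteValuationRing_integralClosure [FiniteDimensional ℚ_[p] E] :
    IsDiscreteValuationRing (integralClosure ℤ_[p] E) := by
  haveI := PadicAlgCl.isDiscreteValuationRing_unitBall E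
  exact IsDiscreteValuationRing.RingEquivClass.isDiscreteValuationRing
    (A := (Valued.v.comap (algebraMap E (PadicAlgCl p))).valuationSubring)
    (B := integralClosure ℤ_[p] E)
    (RingEquiv.subringCongr (PadicAlgCl.unitBall_toSubring_eq_integralClosure E))

/-- `𝒪_E` is a local ring (it is a discrete valuation ring). [cite: SerreLocalFields1979, Ch. II §2, Prop. 3] -/
theorem isLocalRing_integralClosure [FiniteDimensional ℚ_[p] E] :
    IsLocalRing (integralClosure ℤ_[p] E) :=
  haveI := isDiscreteValuationRing_integralClosure E
  inferInstance

/-- `𝒪_E` is Noetherian (Mathlib `integralClosure.isNoetherianRing`: the integral closure of the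
Noetherian integrally closed `ℤ_p` in the finite separable extension `E/ℚ_p`).
[cite: SerreLocalFields1979, Ch. II §2, Prop. 3] -/
theorem isNoetherianRing_integralClosure [FiniteDimensional ℚ_[p] E] :
    IsNoetherianRing (integralClosure ℤ_[p] E) :=
  integralClosure.isNoetherianRing (A := ℤ_[p]) (K := ℚ_[p]) E

/-- The structure map `ℤ_p → E` (through `ℚ_p`) is injective: `E` is a faithful `ℤ_p`-algebra
(private plumbing). [folklore] -/
private theorem faithfulSMul_padicInt : FaithfulSMul ℤ_[p] E := by
  refine (faithfulSMul_iff_algebraMap_injective ℤ_[p] E).mpr ?_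
  rw [IsScalarTower.algebraMap_eq ℤ_[p] ℚ_[p] E, RingHom.coe_comp]
  exact (algebraMap ℚ_[p] E).injective.comp (IsFractionRing.injective ℤ_[p] ℚ_[p])

/-- `E` is a torsion-free `ℤ_p`-module (private plumbing). [folklore] -/
private theorem isTorsionFree_padicInt : Module.IsTorsionFree ℤ_[p] E :=
  haveI := faithfulSMul_padicInt E
  inferInstance

/-- The structure map `ℤ_p → 𝒪_E` is injective: `𝒪_E` is a faithful `ℤ_p`-algebra (`ℤ_p ⊆ 𝒪_E`, the
integral closure of `ℤ_p` in `E`). [cite: SerreLocalFields1979, Ch. II §2, Prop. 3 (setting: A ⊆ B the integral closure of A in L)] -/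
theorem faithfulSMul_padicInt_integralClosure : FaithfulSMul ℤ_[p] (integralClosure ℤ_[p] E) := by
  refine (faithfulSMul_iff_algebraMap_injective ℤ_[p] (integralClosure ℤ_[p] E)).mpr ?_
  intro x y hxy
  have h := congrArg (algebraMap (integralClosure ℤ_[p] E) E) hxy
  rw [← IsScalarTower.algebraMap_apply, ← IsScalarTower.algebraMap_apply] at h
  exact (faithfulSMul_iff_algebraMap_injective ℤ_[p] E).mp (faithfulSMul_padicInt E) h

/-- **`𝒪_E` is a finitely generated `ℤ_p`-module** (Mathlib `IsIntegralClosure.finite`).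
[cite: SerreLocalFields1979, Ch. II §2, Prop. 3] -/
theorem module_finite_integralClosure [FiniteDimensional ℚ_[p] E] :
    Module.Finite ℤ_[p] (integralClosure ℤ_[p] E) :=
  IsIntegralClosure.finite ℤ_[p] ℚ_[p] E (integralClosure ℤ_[p] E)

/-- `𝒪_E` is a free `ℤ_p`-module (Mathlib `IsIntegralClosure.module_free`, `ℤ_p` principal).
[cite: SerreLocalFields1979, Ch. II §2, Prop. 3] -/
theorem module_free_integralClosure [FiniteDimensional ℚ_[p] E] :
    Module.Free ℤ_[p] (integralClosure ℤ_[p] E) :=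
  haveI := isTorsionFree_padicInt E
  IsIntegralClosure.module_free ℤ_[p] ℚ_[p] E (integralClosure ℤ_[p] E)

/-- `rk_{ℤ_p} 𝒪_E = [E : ℚ_p]` (Mathlib `IsIntegralClosure.rank`).
[cite: SerreLocalFields1979, Ch. II §2, Prop. 3] -/
theorem finrank_integralClosure [FiniteDimensional ℚ_[p] E] :
    Module.finrank ℤ_[p] (integralClosure ℤ_[p] E) = Module.finrank ℚ_[p] E :=
  haveI := isTorsionFree_padicInt E
  IsIntegralClosure.rank ℤ_[p] ℚ_[p] E (integralClosure ℤ_[p] E)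

/-! ## §2 `p ∈ 𝔪_E`, `p ≠ 0`, finite residue field of characteristic `p`, completeness -/

/-- `p` is not a unit of `𝒪_E` (its `p`-adic norm is `< 1`; transported from the tree's
`PadicAlgCl.natCast_mem_maximalIdeal_unitBall`). [cite: SerreLocalFields1979, Ch. II §2, Prop. 3] -/
theorem not_isUnit_natCast_integralClosure [FiniteDimensional ℚ_[p] E] :
    ¬ IsUnit ((p : ℕ) : integralClosure ℤ_[p] E) := by
  intro hu
  set e : (Valued.v.comap (algebraMap E (PadicAlgCl p))).valuationSubring ≃+*
      integralClosure ℤ_[p] E :=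
    RingEquiv.subringCongr (PadicAlgCl.unitBall_toSubring_eq_integralClosure E) with he
  have h1 : IsUnit (e.symm ((p : ℕ) : integralClosure ℤ_[p] E)) := hu.map e.symm
  rw [map_natCast] at h1
  exact (IsLocalRing.mem_maximalIdeal _).mp (PadicAlgCl.natCast_mem_maximalIdeal_unitBall E) h1

/-- **`p ∈ 𝔪_E`**: `p` lies in the maximal ideal of `𝒪_E`.
[cite: Howard2004HeegnerKolyvagin, §1 conventions (residue field of characteristic p)] [cite: SerreLocalFields1979, Ch. II §2, Prop. 3] -/
theorem natCast_mem_maximalIdeal_integralClosure [FiniteDimensional ℚ_[p] E] :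
    haveI := isLocalRing_integralClosure E
    ((p : ℕ) : integralClosure ℤ_[p] E) ∈ maximalIdeal (integralClosure ℤ_[p] E) := by
  haveI := isLocalRing_integralClosure E
  exact (IsLocalRing.mem_maximalIdeal _).mpr (not_isUnit_natCast_integralClosure E)

/-- **`p ≠ 0` in `𝒪_E`** (`E` has characteristic zero) — the guard `((p : ℕ) : R) ≠ 0` of the
print-as-intended Thm. 1.6.1 (`thm161_dvrKolyvaginBound_printIntended`) at `R = 𝒪_E`.
[cite: Howard2004HeegnerKolyvagin, §1 conventions (arXiv p. 4, L49–51: «the cases of interest are … 𝒪 …»)] -/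
theorem natCast_ne_zero_integralClosure : ((p : ℕ) : integralClosure ℤ_[p] E) ≠ 0 := by
  intro h
  have h' : ((p : ℕ) : E) = 0 := by
    have := congrArg (algebraMap (integralClosure ℤ_[p] E) E) h
    rwa [map_natCast, map_zero] at this
  haveI : CharZero E := charZero_of_injective_algebraMap (algebraMap ℚ_[p] E).injective
  exact hp.out.ne_zero (by exact_mod_cast h')

/-- The structure map `ℤ_p → 𝒪_E` is a local homomorphism (an injective integral ring map
between local rings; Mathlib `RingHom.IsIntegral.isLocalHom`). [cite: SerreLocalFields1979, Ch. II §2, Prop. 3] -/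
theorem isLocalHom_algebraMap_integralClosure [FiniteDimensional ℚ_[p] E] :
    IsLocalHom (algebraMap ℤ_[p] (integralClosure ℤ_[p] E)) := by
  haveI := module_finite_integralClosure E
  haveI : Algebra.IsIntegral ℤ_[p] (integralClosure ℤ_[p] E) := Algebra.IsIntegral.of_finite _ _
  haveI := faithfulSMul_padicInt_integralClosure E
  exact Algebra.IsIntegral.isLocalHom ℤ_[p] (integralClosure ℤ_[p] E)

/-- **The residue field of `𝒪_E` is finite**: `𝒪_E` is module-finite over `ℤ_p` through a local
homomorphism, so `𝒪_E/𝔪_E` is a finite-dimensional vector space over `ℤ_p/(p) = 𝔽_p`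
(Mathlib `IsLocalRing.ResidueField.finite_of_finite`, `PadicInt.residueField`).
[cite: Howard2004HeegnerKolyvagin, §1 conventions (arXiv p. 4, L47–52: finite residue field)] [cite: SerreLocalFields1979, Ch. II §2, Prop. 3] -/
theorem finite_residueField_integralClosure [FiniteDimensional ℚ_[p] E] :
    haveI := isLocalRing_integralClosure E
    Finite (ResidueField (integralClosure ℤ_[p] E)) := by
  haveI := isLocalRing_integralClosure E
  haveI := module_finite_integralClosure E
  haveI := isLocalHom_algebraMap_integralClosure E
  have hfin : Finite (ResidueField ℤ_[p]) := Finite.of_equiv (ZMod p) PadicInt.residueField.symm.toEquiv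
  exact IsLocalRing.ResidueField.finite_of_finite hfin

/-- **The residue field of `𝒪_E` has characteristic `p`** (`p ∈ 𝔪_E`).
[cite: Howard2004HeegnerKolyvagin, §1 conventions (arXiv p. 4, L47–52: residue field of characteristic p)] -/
theorem charP_residueField_integralClosure [FiniteDimensional ℚ_[p] E] :
    haveI := isLocalRing_integralClosure E
    CharP (ResidueField (integralClosure ℤ_[p] E)) p := by
  haveI := isLocalRing_integralClosure E
  refine (CharP.charP_iff_prime_eq_zero hp.out).mpr ?_
  rw [← map_natCast (IsLocalRing.residue (integralClosure ℤ_[p] E)), IsLocalRing.residue_eq_zero_iff]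
  exact natCast_mem_maximalIdeal_integralClosure E

/-- **`𝒪_E` is `𝔪_E`-adically complete**: a local ring which is module-finite over the complete
Noetherian local ring `ℤ_p` is complete (Matsumura Thm. 8.7 / 8.15, the tree's
`Resolution.isAdicComplete_maximalIdeal_of_module_finite`; Mathlib's `IsAdicComplete (𝔪 ℤ_p) ℤ_p`).
[cite: Howard2004HeegnerKolyvagin, §1 conventions (arXiv p. 4, L47–52: complete)] [cite: Matsumura1987, Thm. 8.7 and Thm. 8.15] -/
theorem isAdicComplete_maximalIdeal_integralClosure [FiniteDimensional ℚ_[p] E] :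
    haveI := isLocalRing_integralClosure E
    IsAdicComplete (maximalIdeal (integralClosure ℤ_[p] E)) (integralClosure ℤ_[p] E) := by
  haveI := isLocalRing_integralClosure E
  haveI := module_finite_integralClosure E
  exact Literature.AlgebraicGeometry.Resolution.isAdicComplete_maximalIdeal_of_module_finite ℤ_[p]
    (integralClosure ℤ_[p] E)

/-! ## §3 `𝒪_E` is a coefficient ring -/

/-- **`𝒪_E` is a coefficient ring in Howard's sense** — complete, Noetherian, local, with finite residue
field of characteristic `p`: Howard's standing hypothesis `IsCoefficientRing p R` DISCHARGED for his first
«case of interest», the ring of integers of a finite extension of `ℚ_p` (here any finite `E ⊆ ℚ̄_p`).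
Together with `isDiscreteValuationRing_integralClosure`: `𝒪_E` meets the standing «`R` is a discrete
valuation ring [which is a coefficient ring]» of Thm. 1.6.1, and `S_𝔓 = 𝒪_{Frac(Λ/𝔓)}` that of §2.2.
[cite: Howard2004HeegnerKolyvagin, §1 conventions (arXiv:1202.6340 p. 4, L47–52) and §1.6 Thm. 1.6.1 standing (arXiv p. 11, L13–18); §2.2 (S_𝔓)] [cite: SerreLocalFields1979, Ch. II §2, Prop. 3] -/
theorem isCoefficientRing_integralClosure [FiniteDimensional ℚ_[p] E] :
    @IsCoefficientRing p (integralClosure ℤ_[p] E) _ (isLocalRing_integralClosure E) := by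
  letI := isLocalRing_integralClosure E
  exact
    { isNoetherianRing := isNoetherianRing_integralClosure E
      isAdicComplete := isAdicComplete_maximalIdeal_integralClosure E
      finite_residueField := finite_residueField_integralClosure E
      charP_residueField := charP_residueField_integralClosure E }

end Literature.NumberTheory.GaloisCohomology.Howard2004

end
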